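import Mathlib
import HarnessLib
import Summits.ValiantsHypothesis.ValiantsHypothesis.Theorems.LacunarySymmetroidMatrixDescartesOsculationCensusRankOneCert
import Summits.ValiantsHypothesis.ValiantsHypothesis.Theorems.LacunarySymmetroidMatrixDescartesOsculationLawTwoK
import Summits.ValiantsHypothesis.ValiantsHypothesis.Theorems.LacunarySymmetroidMatrixDescartesOsculationLawTwoKCusp

/-!
# ValiantsHypothesis / LacunarySymmetroid — crux `MatrixDescartes` (stmt-ValiantsHypothesis-18050, V1),
# line «osculation-law» (`Cruxes/MatrixDescartes/Lines/osculation_law.lean`), rung O3 «extremal-support families from the census»: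
# the RANK-TWO-TOP OSCULATION CERTIFICATE (splitting `(2,0)`: finiteness + cardinality from ONE exact check)

Roster R2664 (b) / R2685 (O3 = val-sym-engine-7), critic val-idea-crit-1 VERDICT #76 / #85 (finiteness PROVED, not assumed).
Companion of `…OsculationCensusRankOneCert` (the rank-one splittings); the instance (G6 stamp pencil at `P = I`) is filed
separately.

CONTENT.  `OsculationCensus.osc_rankTwoTop_finite_card_le` (every `K`): for a `2 × 2` pencil `G(t) = Σ_l t^{d_l} S_l` on
`Fin 2 ⊕ Fin 0` write `τ = tr G`, `δ = det G`, so that the insertion polynomial is the cusp curve `Φ = b² + τ(t) b + δ(t)`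
(`OsculationTwoK.insertionPoly_two_zero`), and let `A`, `B ∈ ℝ[t]` be the remainder of the bordered log-Hessian modulo `Φ`
(`H ≡ A·b + B` on the curve, `OsculationCusp.hess_reduce_poly`; explicit `θ`-polynomials in `τ, δ`) and
`N = B² − τ·A·B + δ·A²`.  If `N ≢ 0` then the osculation set in the open quadrant (the line's `osculationSet d S`, UNFOLDED
verbatim) is FINITE with at most `2·#roots(N) ≤ 24·n` points whenever `deg τ ≤ n`, `deg δ ≤ 2n`: every osculation abscissa
`t` is a root of `N` (`N(t) = A(t)²·Φ(t,b) = 0` after `B(t) = −A(t)·b`), and over each abscissa the ordinate is a root of the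
monic quadratic `Φ(t,·)`.  The symmetry hypothesis of the line is idle here (no real-rootedness of `Φ(t,·)` is needed for an
upper bound).  Degree bookkeeping: `natDegree_cuspA_le` (`≤ 5n`), `natDegree_cuspB_le` (`≤ 6n`), `natDegree_cuspN_le`
(`≤ 12n`); evaluation form `eval_cuspN_of` (for the instances' `N(t₀) ≠ 0` checks, over the tree's `OsculationCusp.eval_A/eval_B`).

HONEST FRAMING.  Calibration tooling for a line stub: `m = 2` is covered by the line's rung `rungTwo : OsculationLawAt 2 K
(16·K¹²)`; the LAW `stub_osculationLaw` (Conjecture-B strength), the crux `MatrixDescartes`, Conjecture B and `VP ≠ VNP` are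
OPEN / NOT proved; no summit statement is proved by this file.  No definitions, no named facts; Mathlib + tree files
(`…OsculationCensusRankOneCert`, `…OsculationLawTwoK`, `…OsculationLawTwoKCusp`).
-/

-- `Summit.ValiantsHypothesis.ValiantsHypothesis.…` is the tree's mandated single-conjunct layout (Sub = Summit).
set_option linter.dupNamespace false

noncomputable section

namespace Summit.ValiantsHypothesis.ValiantsHypothesis.Theorems.LacunarySymmetroidMatrixDescartes

open Polynomial Matrix Finset
open scoped BigOperators

namespace OsculationCensus

/-! ### Degree bookkeeping for the cusp remainders `A`, `B` and the eliminant `N` -/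

/-- Sum rule with a common bound. [folklore] -/
theorem natDegree_add_le_of_le' {p q : ℝ[X]} {m : ℕ} (hp : p.natDegree ≤ m) (hq : q.natDegree ≤ m) :
    (p + q).natDegree ≤ m := (natDegree_add_le p q).trans (max_le hp hq)

/-- Difference rule with a common bound. [folklore] -/
theorem natDegree_sub_le_of_le' {p q : ℝ[X]} {m : ℕ} (hp : p.natDegree ≤ m) (hq : q.natDegree ≤ m) :
    (p - q).natDegree ≤ m := (natDegree_sub_le p q).trans (max_le hp hq)

/-- `deg A ≤ 5n` for the `b`-coefficient of the Hessian remainder. [folklore] -/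
theorem natDegree_cuspA_le (τ δ : ℝ[X]) (n : ℕ) (hτ : τ.natDegree ≤ n) (hδ : δ.natDegree ≤ 2 * n) :
    (τ ^ 4 * (X * derivative (X * derivative τ)) - τ ^ 3 * (X * derivative τ) ^ 2 - τ ^ 3 * (X * derivative (X * derivative δ)) - 5 * τ ^ 2 * δ * (X * derivative (X * derivative τ)) + 4 * τ ^ 2 * (X * derivative τ) * (X * derivative δ) + τ * δ * (X * derivative τ) ^ 2 + 4 * τ * δ * (X * derivative (X * derivative δ)) - 3 * τ * (X * derivative δ) ^ 2 + 4 * δ ^ 2 * (X * derivative (X * derivative τ)) - 4 * δ * (X * derivative τ) * (X * derivative δ)).natDegree ≤ 5 * n := by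
  have hT1 : (X * derivative τ).natDegree ≤ n := (natDegree_X_mul_derivative_le τ).trans hτ
  have hT2 : (X * derivative (X * derivative τ)).natDegree ≤ n := (natDegree_X_mul_derivative_le _).trans hT1
  have hD1 : (X * derivative δ).natDegree ≤ 2 * n := (natDegree_X_mul_derivative_le δ).trans hδ
  have hD2 : (X * derivative (X * derivative δ)).natDegree ≤ 2 * n := (natDegree_X_mul_derivative_le _).trans hD1
  have h3 : (3 : ℝ[X]).natDegree ≤ 0 := by simp
  have h4 : (4 : ℝ[X]).natDegree ≤ 0 := by simp
  have h5 : (5 : ℝ[X]).natDegree ≤ 0 := by simp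
  have t1 : (τ ^ 4 * (X * derivative (X * derivative τ))).natDegree ≤ 5 * n :=
    (natDegree_mul_le_of_le (natDegree_pow_le_of_le 4 hτ) hT2).trans (by omega)
  have t2 : (τ ^ 3 * (X * derivative τ) ^ 2).natDegree ≤ 5 * n :=
    (natDegree_mul_le_of_le (natDegree_pow_le_of_le 3 hτ) (natDegree_pow_le_of_le 2 hT1)).trans (by omega)
  have t3 : (τ ^ 3 * (X * derivative (X * derivative δ))).natDegree ≤ 5 * n :=
    (natDegree_mul_le_of_le (natDegree_pow_le_of_le 3 hτ) hD2).trans (by omega)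
  have t4 : (5 * τ ^ 2 * δ * (X * derivative (X * derivative τ))).natDegree ≤ 5 * n :=
    (natDegree_mul_le_of_le (natDegree_mul_le_of_le (natDegree_mul_le_of_le h5 (natDegree_pow_le_of_le 2 hτ)) hδ)
      hT2).trans (by omega)
  have t5 : (4 * τ ^ 2 * (X * derivative τ) * (X * derivative δ)).natDegree ≤ 5 * n :=
    (natDegree_mul_le_of_le (natDegree_mul_le_of_le (natDegree_mul_le_of_le h4 (natDegree_pow_le_of_le 2 hτ)) hT1)
      hD1).trans (by omega)
  have t6 : (τ * δ * (X * derivative τ) ^ 2).natDegree ≤ 5 * n :=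
    (natDegree_mul_le_of_le (natDegree_mul_le_of_le hτ hδ) (natDegree_pow_le_of_le 2 hT1)).trans (by omega)
  have t7 : (4 * τ * δ * (X * derivative (X * derivative δ))).natDegree ≤ 5 * n :=
    (natDegree_mul_le_of_le (natDegree_mul_le_of_le (natDegree_mul_le_of_le h4 hτ) hδ) hD2).trans (by omega)
  have t8 : (3 * τ * (X * derivative δ) ^ 2).natDegree ≤ 5 * n :=
    (natDegree_mul_le_of_le (natDegree_mul_le_of_le h3 hτ) (natDegree_pow_le_of_le 2 hD1)).trans (by omega)
  have t9 : (4 * δ ^ 2 * (X * derivative (X * derivative τ))).natDegree ≤ 5 * n :=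
    (natDegree_mul_le_of_le (natDegree_mul_le_of_le h4 (natDegree_pow_le_of_le 2 hδ)) hT2).trans (by omega)
  have t10 : (4 * δ * (X * derivative τ) * (X * derivative δ)).natDegree ≤ 5 * n :=
    (natDegree_mul_le_of_le (natDegree_mul_le_of_le (natDegree_mul_le_of_le h4 hδ) hT1) hD1).trans (by omega)
  exact natDegree_sub_le_of_le' (natDegree_add_le_of_le' (natDegree_sub_le_of_le' (natDegree_add_le_of_le'
    (natDegree_add_le_of_le' (natDegree_add_le_of_le' (natDegree_sub_le_of_le' (natDegree_sub_le_of_le'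
    (natDegree_sub_le_of_le' t1 t2) t3) t4) t5) t6) t7) t8) t9) t10

/-- `deg B ≤ 6n` for the constant coefficient of the Hessian remainder. [folklore] -/
theorem natDegree_cuspB_le (τ δ : ℝ[X]) (n : ℕ) (hτ : τ.natDegree ≤ n) (hδ : δ.natDegree ≤ 2 * n) :
    (τ ^ 3 * δ * (X * derivative (X * derivative τ)) - τ ^ 2 * δ * (X * derivative τ) ^ 2 - τ ^ 2 * δ * (X * derivative (X * derivative δ)) - 4 * τ * δ ^ 2 * (X * derivative (X * derivative τ)) + 4 * τ * δ * (X * derivative τ) * (X * derivative δ) + 4 * δ ^ 2 * (X * derivative (X * derivative δ)) - 4 * δ * (X * derivative δ) ^ 2).natDegree ≤ 6 * n := by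
  have hT1 : (X * derivative τ).natDegree ≤ n := (natDegree_X_mul_derivative_le τ).trans hτ
  have hT2 : (X * derivative (X * derivative τ)).natDegree ≤ n := (natDegree_X_mul_derivative_le _).trans hT1
  have hD1 : (X * derivative δ).natDegree ≤ 2 * n := (natDegree_X_mul_derivative_le δ).trans hδ
  have hD2 : (X * derivative (X * derivative δ)).natDegree ≤ 2 * n := (natDegree_X_mul_derivative_le _).trans hD1
  have h4 : (4 : ℝ[X]).natDegree ≤ 0 := by simp
  have t1 : (τ ^ 3 * δ * (X * derivative (X * derivative τ))).natDegree ≤ 6 * n :=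
    (natDegree_mul_le_of_le (natDegree_mul_le_of_le (natDegree_pow_le_of_le 3 hτ) hδ) hT2).trans (by omega)
  have t2 : (τ ^ 2 * δ * (X * derivative τ) ^ 2).natDegree ≤ 6 * n :=
    (natDegree_mul_le_of_le (natDegree_mul_le_of_le (natDegree_pow_le_of_le 2 hτ) hδ)
      (natDegree_pow_le_of_le 2 hT1)).trans (by omega)
  have t3 : (τ ^ 2 * δ * (X * derivative (X * derivative δ))).natDegree ≤ 6 * n :=
    (natDegree_mul_le_of_le (natDegree_mul_le_of_le (natDegree_pow_le_of_le 2 hτ) hδ) hD2).trans (by omega)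
  have t4 : (4 * τ * δ ^ 2 * (X * derivative (X * derivative τ))).natDegree ≤ 6 * n :=
    (natDegree_mul_le_of_le (natDegree_mul_le_of_le (natDegree_mul_le_of_le h4 hτ) (natDegree_pow_le_of_le 2 hδ))
      hT2).trans (by omega)
  have t5 : (4 * τ * δ * (X * derivative τ) * (X * derivative δ)).natDegree ≤ 6 * n :=
    (natDegree_mul_le_of_le (natDegree_mul_le_of_le (natDegree_mul_le_of_le (natDegree_mul_le_of_le h4 hτ) hδ) hT1)
      hD1).trans (by omega)
  have t6 : (4 * δ ^ 2 * (X * derivative (X * derivative δ))).natDegree ≤ 6 * n :=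
    (natDegree_mul_le_of_le (natDegree_mul_le_of_le h4 (natDegree_pow_le_of_le 2 hδ)) hD2).trans (by omega)
  have t7 : (4 * δ * (X * derivative δ) ^ 2).natDegree ≤ 6 * n :=
    (natDegree_mul_le_of_le (natDegree_mul_le_of_le h4 hδ) (natDegree_pow_le_of_le 2 hD1)).trans (by omega)
  exact natDegree_sub_le_of_le' (natDegree_add_le_of_le' (natDegree_add_le_of_le' (natDegree_sub_le_of_le'
    (natDegree_sub_le_of_le' (natDegree_sub_le_of_le' t1 t2) t3) t4) t5) t6) t7

/-- `deg N ≤ 12n` for the cusp eliminant `N = B² − τAB + δA²`. [folklore] -/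
theorem natDegree_cuspN_le (τ δ : ℝ[X]) (n : ℕ) (hτ : τ.natDegree ≤ n) (hδ : δ.natDegree ≤ 2 * n) :
    ((τ ^ 3 * δ * (X * derivative (X * derivative τ)) - τ ^ 2 * δ * (X * derivative τ) ^ 2 - τ ^ 2 * δ * (X * derivative (X * derivative δ)) - 4 * τ * δ ^ 2 * (X * derivative (X * derivative τ)) + 4 * τ * δ * (X * derivative τ) * (X * derivative δ) + 4 * δ ^ 2 * (X * derivative (X * derivative δ)) - 4 * δ * (X * derivative δ) ^ 2) ^ 2
        - τ * (τ ^ 4 * (X * derivative (X * derivative τ)) - τ ^ 3 * (X * derivative τ) ^ 2 - τ ^ 3 * (X * derivative (X * derivative δ)) - 5 * τ ^ 2 * δ * (X * derivative (X * derivative τ)) + 4 * τ ^ 2 * (X * derivative τ) * (X * derivative δ) + τ * δ * (X * derivative τ) ^ 2 + 4 * τ * δ * (X * derivative (X * derivative δ)) - 3 * τ * (X * derivative δ) ^ 2 + 4 * δ ^ 2 * (X * derivative (X * derivative τ)) - 4 * δ * (X * derivative τ) * (X * derivative δ))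
          * (τ ^ 3 * δ * (X * derivative (X * derivative τ)) - τ ^ 2 * δ * (X * derivative τ) ^ 2 - τ ^ 2 * δ * (X * derivative (X * derivative δ)) - 4 * τ * δ ^ 2 * (X * derivative (X * derivative τ)) + 4 * τ * δ * (X * derivative τ) * (X * derivative δ) + 4 * δ ^ 2 * (X * derivative (X * derivative δ)) - 4 * δ * (X * derivative δ) ^ 2)
        + δ * (τ ^ 4 * (X * derivative (X * derivative τ)) - τ ^ 3 * (X * derivative τ) ^ 2 - τ ^ 3 * (X * derivative (X * derivative δ)) - 5 * τ ^ 2 * δ * (X * derivative (X * derivative τ)) + 4 * τ ^ 2 * (X * derivative τ) * (X * derivative δ) + τ * δ * (X * derivative τ) ^ 2 + 4 * τ * δ * (X * derivative (X * derivative δ)) - 3 * τ * (X * derivative δ) ^ 2 + 4 * δ ^ 2 * (X * derivative (X * derivative τ)) - 4 * δ * (X * derivative τ) * (X * derivative δ)) ^ 2).natDegree ≤ 12 * n := by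
  have hA := natDegree_cuspA_le τ δ n hτ hδ
  have hB := natDegree_cuspB_le τ δ n hτ hδ
  refine natDegree_add_le_of_le' (natDegree_sub_le_of_le' ?_ ?_) ?_
  · exact (natDegree_pow_le_of_le 2 hB).trans (by omega)
  · exact (natDegree_mul_le_of_le (natDegree_mul_le_of_le hτ hA) hB).trans (by omega)
  · exact (natDegree_mul_le_of_le hδ (natDegree_pow_le_of_le 2 hA)).trans (by omega)

/-- The cusp eliminant evaluated at a point, in terms of the six numbers `τ(t), τ'(t), τ''(t), δ(t), δ'(t), δ''(t)`
and the two remainder values `A(t)`, `B(t)` (over the tree's `OsculationCusp.eval_A`, `eval_B`); used for the instances'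
`N(t₀) ≠ 0` checks. [folklore] -/
theorem eval_cuspN_of (τ δ : ℝ[X]) (t T T' T'' D D' D'' Av Bv : ℝ) (hT : τ.eval t = T) (hT' : (derivative τ).eval t = T')
    (hT'' : (derivative (derivative τ)).eval t = T'') (hD : δ.eval t = D) (hD' : (derivative δ).eval t = D')
    (hD'' : (derivative (derivative δ)).eval t = D'')
    (hAv : Av = T ^ 4 * (t * T' + t ^ 2 * T'') - T ^ 3 * (t * T') ^ 2 - T ^ 3 * (t * D' + t ^ 2 * D'') - 5 * T ^ 2 * D * (t * T' + t ^ 2 * T'') + 4 * T ^ 2 * (t * T') * (t * D') + T * D * (t * T') ^ 2 + 4 * T * D * (t * D' + t ^ 2 * D'') - 3 * T * (t * D') ^ 2 + 4 * D ^ 2 * (t * T' + t ^ 2 * T'') - 4 * D * (t * T') * (t * D'))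
    (hBv : Bv = T ^ 3 * D * (t * T' + t ^ 2 * T'') - T ^ 2 * D * (t * T') ^ 2 - T ^ 2 * D * (t * D' + t ^ 2 * D'') - 4 * T * D ^ 2 * (t * T' + t ^ 2 * T'') + 4 * T * D * (t * T') * (t * D') + 4 * D ^ 2 * (t * D' + t ^ 2 * D'') - 4 * D * (t * D') ^ 2) :
    ((τ ^ 3 * δ * (X * derivative (X * derivative τ)) - τ ^ 2 * δ * (X * derivative τ) ^ 2 - τ ^ 2 * δ * (X * derivative (X * derivative δ)) - 4 * τ * δ ^ 2 * (X * derivative (X * derivative τ)) + 4 * τ * δ * (X * derivative τ) * (X * derivative δ) + 4 * δ ^ 2 * (X * derivative (X * derivative δ)) - 4 * δ * (X * derivative δ) ^ 2) ^ 2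
        - τ * (τ ^ 4 * (X * derivative (X * derivative τ)) - τ ^ 3 * (X * derivative τ) ^ 2 - τ ^ 3 * (X * derivative (X * derivative δ)) - 5 * τ ^ 2 * δ * (X * derivative (X * derivative τ)) + 4 * τ ^ 2 * (X * derivative τ) * (X * derivative δ) + τ * δ * (X * derivative τ) ^ 2 + 4 * τ * δ * (X * derivative (X * derivative δ)) - 3 * τ * (X * derivative δ) ^ 2 + 4 * δ ^ 2 * (X * derivative (X * derivative τ)) - 4 * δ * (X * derivative τ) * (X * derivative δ))
          * (τ ^ 3 * δ * (X * derivative (X * derivative τ)) - τ ^ 2 * δ * (X * derivative τ) ^ 2 - τ ^ 2 * δ * (X * derivative (X * derivative δ)) - 4 * τ * δ ^ 2 * (X * derivative (X * derivative τ)) + 4 * τ * δ * (X * derivative τ) * (X * derivative δ) + 4 * δ ^ 2 * (X * derivative (X * derivative δ)) - 4 * δ * (X * derivative δ) ^ 2)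
        + δ * (τ ^ 4 * (X * derivative (X * derivative τ)) - τ ^ 3 * (X * derivative τ) ^ 2 - τ ^ 3 * (X * derivative (X * derivative δ)) - 5 * τ ^ 2 * δ * (X * derivative (X * derivative τ)) + 4 * τ ^ 2 * (X * derivative τ) * (X * derivative δ) + τ * δ * (X * derivative τ) ^ 2 + 4 * τ * δ * (X * derivative (X * derivative δ)) - 3 * τ * (X * derivative δ) ^ 2 + 4 * δ ^ 2 * (X * derivative (X * derivative τ)) - 4 * δ * (X * derivative τ) * (X * derivative δ)) ^ 2).eval t =
      Bv ^ 2 - T * Av * Bv + D * Av ^ 2 := by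
  subst hAv hBv
  simp only [eval_add, eval_sub, eval_mul, eval_pow, eval_X, eval_ofNat, derivative_mul, derivative_X, one_mul,
    hT, hT', hT'', hD, hD', hD'']
  ring

/-! ### The rank-two-top certificate theorem (splitting `(2,0)`) -/

set_option maxHeartbeats 400000 in
/-- **Rank-two-top osculation certificate.**  For a `2 × 2` pencil `G(t) = Σ_l t^(d l) S_l` on `Fin 2 ⊕ Fin 0` with
`τ = tr G`, `δ = det G`, Hessian remainder `A·b + B` and `N = B² − τ·A·B + δ·A²`: if `N ≢ 0`, then the osculation set of the
spectral curve `det(G(t) + b·I) = 0` in the open quadrant `t > 0, b > 0` (the line's `osculationSet d S` with `blockProj`,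
`insertionPoly`, `euler`, `logHessian` UNFOLDED verbatim) is finite and has at most `24·n` points whenever `deg τ ≤ n` and
`deg δ ≤ 2n`. [folklore] -/
theorem osc_rankTwoTop_finite_card_le {K : ℕ} (d : Fin K → ℕ) (S : Fin K → Matrix (Fin 2 ⊕ Fin 0) (Fin 2 ⊕ Fin 0) ℝ)
    (τ δ : ℝ[X])
    (hτ : (∑ l, (X : ℝ[X]) ^ d l • (S l).map Polynomial.C) (Sum.inl 0) (Sum.inl 0) + (∑ l, (X : ℝ[X]) ^ d l • (S l).map Polynomial.C) (Sum.inl 1) (Sum.inl 1) = τ)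
    (hδ : (∑ l, (X : ℝ[X]) ^ d l • (S l).map Polynomial.C) (Sum.inl 0) (Sum.inl 0) * (∑ l, (X : ℝ[X]) ^ d l • (S l).map Polynomial.C) (Sum.inl 1) (Sum.inl 1) - (∑ l, (X : ℝ[X]) ^ d l • (S l).map Polynomial.C) (Sum.inl 0) (Sum.inl 1) * (∑ l, (X : ℝ[X]) ^ d l • (S l).map Polynomial.C) (Sum.inl 1) (Sum.inl 0) = δ)
    (hN : (τ ^ 3 * δ * (X * derivative (X * derivative τ)) - τ ^ 2 * δ * (X * derivative τ) ^ 2 - τ ^ 2 * δ * (X * derivative (X * derivative δ)) - 4 * τ * δ ^ 2 * (X * derivative (X * derivative τ)) + 4 * τ * δ * (X * derivative τ) * (X * derivative δ) + 4 * δ ^ 2 * (X * derivative (X * derivative δ)) - 4 * δ * (X * derivative δ) ^ 2) ^ 2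
        - τ * (τ ^ 4 * (X * derivative (X * derivative τ)) - τ ^ 3 * (X * derivative τ) ^ 2 - τ ^ 3 * (X * derivative (X * derivative δ)) - 5 * τ ^ 2 * δ * (X * derivative (X * derivative τ)) + 4 * τ ^ 2 * (X * derivative τ) * (X * derivative δ) + τ * δ * (X * derivative τ) ^ 2 + 4 * τ * δ * (X * derivative (X * derivative δ)) - 3 * τ * (X * derivative δ) ^ 2 + 4 * δ ^ 2 * (X * derivative (X * derivative τ)) - 4 * δ * (X * derivative τ) * (X * derivative δ))
          * (τ ^ 3 * δ * (X * derivative (X * derivative τ)) - τ ^ 2 * δ * (X * derivative τ) ^ 2 - τ ^ 2 * δ * (X * derivative (X * derivative δ)) - 4 * τ * δ ^ 2 * (X * derivative (X * derivative τ)) + 4 * τ * δ * (X * derivative τ) * (X * derivative δ) + 4 * δ ^ 2 * (X * derivative (X * derivative δ)) - 4 * δ * (X * derivative δ) ^ 2)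
        + δ * (τ ^ 4 * (X * derivative (X * derivative τ)) - τ ^ 3 * (X * derivative τ) ^ 2 - τ ^ 3 * (X * derivative (X * derivative δ)) - 5 * τ ^ 2 * δ * (X * derivative (X * derivative τ)) + 4 * τ ^ 2 * (X * derivative τ) * (X * derivative δ) + τ * δ * (X * derivative τ) ^ 2 + 4 * τ * δ * (X * derivative (X * derivative δ)) - 3 * τ * (X * derivative δ) ^ 2 + 4 * δ ^ 2 * (X * derivative (X * derivative τ)) - 4 * δ * (X * derivative τ) * (X * derivative δ)) ^ 2 ≠ 0)
    (n : ℕ) (hτn : τ.natDegree ≤ n) (hδn : δ.natDegree ≤ 2 * n) :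
    {p : Fin 2 → ℝ | 0 < p 0 ∧ 0 < p 1 ∧ MvPolynomial.eval p (∑ l, (MvPolynomial.X (0 : Fin 2) : MvPolynomial (Fin 2) ℝ) ^ d l •
              (S l).map (MvPolynomial.C : ℝ →+* MvPolynomial (Fin 2) ℝ)
            + (MvPolynomial.X (1 : Fin 2) : MvPolynomial (Fin 2) ℝ) •
              (Matrix.fromBlocks 1 0 0 0 : Matrix (Fin 2 ⊕ Fin 0) (Fin 2 ⊕ Fin 0) ℝ).map
                (MvPolynomial.C : ℝ →+* MvPolynomial (Fin 2) ℝ)).det = 0 ∧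
      MvPolynomial.eval p
        (MvPolynomial.X 0 * MvPolynomial.pderiv 0 (MvPolynomial.X 0 * MvPolynomial.pderiv 0 (∑ l, (MvPolynomial.X (0 : Fin 2) : MvPolynomial (Fin 2) ℝ) ^ d l •
              (S l).map (MvPolynomial.C : ℝ →+* MvPolynomial (Fin 2) ℝ)
            + (MvPolynomial.X (1 : Fin 2) : MvPolynomial (Fin 2) ℝ) •
              (Matrix.fromBlocks 1 0 0 0 : Matrix (Fin 2 ⊕ Fin 0) (Fin 2 ⊕ Fin 0) ℝ).map
                (MvPolynomial.C : ℝ →+* MvPolynomial (Fin 2) ℝ)).det)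
            * (MvPolynomial.X 1 * MvPolynomial.pderiv 1 (∑ l, (MvPolynomial.X (0 : Fin 2) : MvPolynomial (Fin 2) ℝ) ^ d l •
              (S l).map (MvPolynomial.C : ℝ →+* MvPolynomial (Fin 2) ℝ)
            + (MvPolynomial.X (1 : Fin 2) : MvPolynomial (Fin 2) ℝ) •
              (Matrix.fromBlocks 1 0 0 0 : Matrix (Fin 2 ⊕ Fin 0) (Fin 2 ⊕ Fin 0) ℝ).map
                (MvPolynomial.C : ℝ →+* MvPolynomial (Fin 2) ℝ)).det) ^ 2
          - 2 * (MvPolynomial.X 0 * MvPolynomial.pderiv 0 (MvPolynomial.X 1 * MvPolynomial.pderiv 1 (∑ l, (MvPolynomial.X (0 : Fin 2) : MvPolynomial (Fin 2) ℝ) ^ d l •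
              (S l).map (MvPolynomial.C : ℝ →+* MvPolynomial (Fin 2) ℝ)
            + (MvPolynomial.X (1 : Fin 2) : MvPolynomial (Fin 2) ℝ) •
              (Matrix.fromBlocks 1 0 0 0 : Matrix (Fin 2 ⊕ Fin 0) (Fin 2 ⊕ Fin 0) ℝ).map
                (MvPolynomial.C : ℝ →+* MvPolynomial (Fin 2) ℝ)).det))
            * (MvPolynomial.X 0 * MvPolynomial.pderiv 0 (∑ l, (MvPolynomial.X (0 : Fin 2) : MvPolynomial (Fin 2) ℝ) ^ d l •
              (S l).map (MvPolynomial.C : ℝ →+* MvPolynomial (Fin 2) ℝ)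
            + (MvPolynomial.X (1 : Fin 2) : MvPolynomial (Fin 2) ℝ) •
              (Matrix.fromBlocks 1 0 0 0 : Matrix (Fin 2 ⊕ Fin 0) (Fin 2 ⊕ Fin 0) ℝ).map
                (MvPolynomial.C : ℝ →+* MvPolynomial (Fin 2) ℝ)).det) * (MvPolynomial.X 1 * MvPolynomial.pderiv 1 (∑ l, (MvPolynomial.X (0 : Fin 2) : MvPolynomial (Fin 2) ℝ) ^ d l •
              (S l).map (MvPolynomial.C : ℝ →+* MvPolynomial (Fin 2) ℝ)
            + (MvPolynomial.X (1 : Fin 2) : MvPolynomial (Fin 2) ℝ) •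
              (Matrix.fromBlocks 1 0 0 0 : Matrix (Fin 2 ⊕ Fin 0) (Fin 2 ⊕ Fin 0) ℝ).map
                (MvPolynomial.C : ℝ →+* MvPolynomial (Fin 2) ℝ)).det)
          + MvPolynomial.X 1 * MvPolynomial.pderiv 1 (MvPolynomial.X 1 * MvPolynomial.pderiv 1 (∑ l, (MvPolynomial.X (0 : Fin 2) : MvPolynomial (Fin 2) ℝ) ^ d l •
              (S l).map (MvPolynomial.C : ℝ →+* MvPolynomial (Fin 2) ℝ)
            + (MvPolynomial.X (1 : Fin 2) : MvPolynomial (Fin 2) ℝ) •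
              (Matrix.fromBlocks 1 0 0 0 : Matrix (Fin 2 ⊕ Fin 0) (Fin 2 ⊕ Fin 0) ℝ).map
                (MvPolynomial.C : ℝ →+* MvPolynomial (Fin 2) ℝ)).det)
            * (MvPolynomial.X 0 * MvPolynomial.pderiv 0 (∑ l, (MvPolynomial.X (0 : Fin 2) : MvPolynomial (Fin 2) ℝ) ^ d l •
              (S l).map (MvPolynomial.C : ℝ →+* MvPolynomial (Fin 2) ℝ)
            + (MvPolynomial.X (1 : Fin 2) : MvPolynomial (Fin 2) ℝ) •
              (Matrix.fromBlocks 1 0 0 0 : Matrix (Fin 2 ⊕ Fin 0) (Fin 2 ⊕ Fin 0) ℝ).map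
                (MvPolynomial.C : ℝ →+* MvPolynomial (Fin 2) ℝ)).det) ^ 2) = 0}.Finite ∧
    {p : Fin 2 → ℝ | 0 < p 0 ∧ 0 < p 1 ∧ MvPolynomial.eval p (∑ l, (MvPolynomial.X (0 : Fin 2) : MvPolynomial (Fin 2) ℝ) ^ d l •
              (S l).map (MvPolynomial.C : ℝ →+* MvPolynomial (Fin 2) ℝ)
            + (MvPolynomial.X (1 : Fin 2) : MvPolynomial (Fin 2) ℝ) •
              (Matrix.fromBlocks 1 0 0 0 : Matrix (Fin 2 ⊕ Fin 0) (Fin 2 ⊕ Fin 0) ℝ).map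
                (MvPolynomial.C : ℝ →+* MvPolynomial (Fin 2) ℝ)).det = 0 ∧
      MvPolynomial.eval p
        (MvPolynomial.X 0 * MvPolynomial.pderiv 0 (MvPolynomial.X 0 * MvPolynomial.pderiv 0 (∑ l, (MvPolynomial.X (0 : Fin 2) : MvPolynomial (Fin 2) ℝ) ^ d l •
              (S l).map (MvPolynomial.C : ℝ →+* MvPolynomial (Fin 2) ℝ)
            + (MvPolynomial.X (1 : Fin 2) : MvPolynomial (Fin 2) ℝ) •
              (Matrix.fromBlocks 1 0 0 0 : Matrix (Fin 2 ⊕ Fin 0) (Fin 2 ⊕ Fin 0) ℝ).map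
                (MvPolynomial.C : ℝ →+* MvPolynomial (Fin 2) ℝ)).det)
            * (MvPolynomial.X 1 * MvPolynomial.pderiv 1 (∑ l, (MvPolynomial.X (0 : Fin 2) : MvPolynomial (Fin 2) ℝ) ^ d l •
              (S l).map (MvPolynomial.C : ℝ →+* MvPolynomial (Fin 2) ℝ)
            + (MvPolynomial.X (1 : Fin 2) : MvPolynomial (Fin 2) ℝ) •
              (Matrix.fromBlocks 1 0 0 0 : Matrix (Fin 2 ⊕ Fin 0) (Fin 2 ⊕ Fin 0) ℝ).map
                (MvPolynomial.C : ℝ →+* MvPolynomial (Fin 2) ℝ)).det) ^ 2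
          - 2 * (MvPolynomial.X 0 * MvPolynomial.pderiv 0 (MvPolynomial.X 1 * MvPolynomial.pderiv 1 (∑ l, (MvPolynomial.X (0 : Fin 2) : MvPolynomial (Fin 2) ℝ) ^ d l •
              (S l).map (MvPolynomial.C : ℝ →+* MvPolynomial (Fin 2) ℝ)
            + (MvPolynomial.X (1 : Fin 2) : MvPolynomial (Fin 2) ℝ) •
              (Matrix.fromBlocks 1 0 0 0 : Matrix (Fin 2 ⊕ Fin 0) (Fin 2 ⊕ Fin 0) ℝ).map
                (MvPolynomial.C : ℝ →+* MvPolynomial (Fin 2) ℝ)).det))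
            * (MvPolynomial.X 0 * MvPolynomial.pderiv 0 (∑ l, (MvPolynomial.X (0 : Fin 2) : MvPolynomial (Fin 2) ℝ) ^ d l •
              (S l).map (MvPolynomial.C : ℝ →+* MvPolynomial (Fin 2) ℝ)
            + (MvPolynomial.X (1 : Fin 2) : MvPolynomial (Fin 2) ℝ) •
              (Matrix.fromBlocks 1 0 0 0 : Matrix (Fin 2 ⊕ Fin 0) (Fin 2 ⊕ Fin 0) ℝ).map
                (MvPolynomial.C : ℝ →+* MvPolynomial (Fin 2) ℝ)).det) * (MvPolynomial.X 1 * MvPolynomial.pderiv 1 (∑ l, (MvPolynomial.X (0 : Fin 2) : MvPolynomial (Fin 2) ℝ) ^ d l •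
              (S l).map (MvPolynomial.C : ℝ →+* MvPolynomial (Fin 2) ℝ)
            + (MvPolynomial.X (1 : Fin 2) : MvPolynomial (Fin 2) ℝ) •
              (Matrix.fromBlocks 1 0 0 0 : Matrix (Fin 2 ⊕ Fin 0) (Fin 2 ⊕ Fin 0) ℝ).map
                (MvPolynomial.C : ℝ →+* MvPolynomial (Fin 2) ℝ)).det)
          + MvPolynomial.X 1 * MvPolynomial.pderiv 1 (MvPolynomial.X 1 * MvPolynomial.pderiv 1 (∑ l, (MvPolynomial.X (0 : Fin 2) : MvPolynomial (Fin 2) ℝ) ^ d l •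
              (S l).map (MvPolynomial.C : ℝ →+* MvPolynomial (Fin 2) ℝ)
            + (MvPolynomial.X (1 : Fin 2) : MvPolynomial (Fin 2) ℝ) •
              (Matrix.fromBlocks 1 0 0 0 : Matrix (Fin 2 ⊕ Fin 0) (Fin 2 ⊕ Fin 0) ℝ).map
                (MvPolynomial.C : ℝ →+* MvPolynomial (Fin 2) ℝ)).det)
            * (MvPolynomial.X 0 * MvPolynomial.pderiv 0 (∑ l, (MvPolynomial.X (0 : Fin 2) : MvPolynomial (Fin 2) ℝ) ^ d l •
              (S l).map (MvPolynomial.C : ℝ →+* MvPolynomial (Fin 2) ℝ)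
            + (MvPolynomial.X (1 : Fin 2) : MvPolynomial (Fin 2) ℝ) •
              (Matrix.fromBlocks 1 0 0 0 : Matrix (Fin 2 ⊕ Fin 0) (Fin 2 ⊕ Fin 0) ℝ).map
                (MvPolynomial.C : ℝ →+* MvPolynomial (Fin 2) ℝ)).det) ^ 2) = 0}.ncard ≤ 24 * n := by
  classical
  -- the insertion polynomial at `(2,0)`: `Φ = X₁² + X₁·ι τ + ι δ`
  have hΦ := OsculationTwoK.insertionPoly_two_zero K d S
  rw [hτ, hδ] at hΦ
  rw [hΦ]
  set Φ : MvPolynomial (Fin 2) ℝ := MvPolynomial.X 1 * MvPolynomial.X 1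
      + MvPolynomial.X 1 * Polynomial.aeval (MvPolynomial.X 0 : MvPolynomial (Fin 2) ℝ) τ
      + Polynomial.aeval (MvPolynomial.X 0 : MvPolynomial (Fin 2) ℝ) δ with hΦdef
  set A : ℝ[X] := (τ ^ 4 * (X * derivative (X * derivative τ)) - τ ^ 3 * (X * derivative τ) ^ 2 - τ ^ 3 * (X * derivative (X * derivative δ)) - 5 * τ ^ 2 * δ * (X * derivative (X * derivative τ)) + 4 * τ ^ 2 * (X * derivative τ) * (X * derivative δ) + τ * δ * (X * derivative τ) ^ 2 + 4 * τ * δ * (X * derivative (X * derivative δ)) - 3 * τ * (X * derivative δ) ^ 2 + 4 * δ ^ 2 * (X * derivative (X * derivative τ)) - 4 * δ * (X * derivative τ) * (X * derivative δ)) with hAdef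
  set B : ℝ[X] := (τ ^ 3 * δ * (X * derivative (X * derivative τ)) - τ ^ 2 * δ * (X * derivative τ) ^ 2 - τ ^ 2 * δ * (X * derivative (X * derivative δ)) - 4 * τ * δ ^ 2 * (X * derivative (X * derivative τ)) + 4 * τ * δ * (X * derivative τ) * (X * derivative δ) + 4 * δ ^ 2 * (X * derivative (X * derivative δ)) - 4 * δ * (X * derivative δ) ^ 2) with hBdef
  set N : ℝ[X] := B ^ 2 - τ * A * B + δ * A ^ 2 with hNdef
  set osc := {p : Fin 2 → ℝ | 0 < p 0 ∧ 0 < p 1 ∧ MvPolynomial.eval p Φ = 0 ∧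
      MvPolynomial.eval p
        (MvPolynomial.X 0 * MvPolynomial.pderiv 0 (MvPolynomial.X 0 * MvPolynomial.pderiv 0 Φ)
            * (MvPolynomial.X 1 * MvPolynomial.pderiv 1 Φ) ^ 2
          - 2 * (MvPolynomial.X 0 * MvPolynomial.pderiv 0 (MvPolynomial.X 1 * MvPolynomial.pderiv 1 Φ))
            * (MvPolynomial.X 0 * MvPolynomial.pderiv 0 Φ) * (MvPolynomial.X 1 * MvPolynomial.pderiv 1 Φ)
          + MvPolynomial.X 1 * MvPolynomial.pderiv 1 (MvPolynomial.X 1 * MvPolynomial.pderiv 1 Φ)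
            * (MvPolynomial.X 0 * MvPolynomial.pderiv 0 Φ) ^ 2) = 0} with hosc
  -- membership, unfolded to real numbers (tree lemmas `eval_logHessian_Phi2`, `eval_Phi2`)
  have mem_osc : ∀ p : Fin 2 → ℝ, p ∈ osc ↔ 0 < p 0 ∧ 0 < p 1 ∧
      p 1 ^ 2 + p 1 * τ.eval (p 0) + δ.eval (p 0) = 0 ∧
      (((p 0) * (derivative τ).eval (p 0) + (p 0) ^ 2 * (derivative (derivative τ)).eval (p 0)) * (p 1) + ((p 0) * (derivative δ).eval (p 0) + (p 0) ^ 2 * (derivative (derivative δ)).eval (p 0))) * (2 * (p 1) ^ 2 + τ.eval (p 0) * (p 1)) ^ 2 - 2 * (((p 0) * (derivative τ).eval (p 0)) * (p 1)) * (((p 0) * (derivative τ).eval (p 0)) * (p 1) + ((p 0) * (derivative δ).eval (p 0))) * (2 * (p 1) ^ 2 + τ.eval (p 0) * (p 1)) + (4 * (p 1) ^ 2 + τ.eval (p 0) * (p 1)) * (((p 0) * (derivative τ).eval (p 0)) * (p 1) + ((p 0) * (derivative δ).eval (p 0))) ^ 2 = 0 := by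
    intro p
    rw [hosc, Set.mem_setOf_eq, OsculationCusp.eval_logHessian_Phi2 τ δ Φ hΦdef p, hΦdef, OsculationCusp.eval_Phi2]
  -- on the set: `A(t)·b + B(t) = 0` (Hessian remainder) and hence `N(t) = A(t)²·Φ(t,b) = 0`
  have hAB : ∀ p ∈ osc, A.eval (p 0) * p 1 + B.eval (p 0) = 0 := by
    intro p hp
    obtain ⟨-, -, hΦ0, hH⟩ := (mem_osc p).1 hp
    exact (OsculationCusp.hess_reduce_poly τ δ (p 0) (p 1) hΦ0).1 hH
  have hNroot : ∀ p ∈ osc, N.IsRoot (p 0) := by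
    intro p hp
    obtain ⟨-, -, hΦ0, -⟩ := (mem_osc p).1 hp
    have hb : B.eval (p 0) = -(A.eval (p 0) * p 1) := by linarith [hAB p hp]
    rw [IsRoot.def, hNdef]
    simp only [eval_sub, eval_add, eval_mul, eval_pow]
    rw [hb]
    linear_combination (A.eval (p 0)) ^ 2 * hΦ0
  -- the fibre over an abscissa `t`: roots of the monic quadratic `X² + τ(t) X + δ(t)`
  have hq0 : ∀ t : ℝ, (X ^ 2 + C (τ.eval t) * X + C (δ.eval t) : ℝ[X]) ≠ 0 := by
    intro t h
    have := congr_arg (fun r : ℝ[X] => r.coeff 2) h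
    simp at this
  have hqroot : ∀ p ∈ osc, (X ^ 2 + C (τ.eval (p 0)) * X + C (δ.eval (p 0)) : ℝ[X]).IsRoot (p 1) := by
    intro p hp
    obtain ⟨-, -, hΦ0, -⟩ := (mem_osc p).1 hp
    rw [IsRoot.def]
    simp only [eval_add, eval_mul, eval_pow, eval_X, eval_C]
    linear_combination hΦ0
  -- cover by a finite set
  set T : Finset ℝ := N.roots.toFinset with hT
  set F : Finset (Fin 2 → ℝ) := T.biUnion (fun t =>
    ((X ^ 2 + C (τ.eval t) * X + C (δ.eval t) : ℝ[X]).roots.toFinset).image (fun b => (![t, b] : Fin 2 → ℝ))) with hF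
  have hsub : osc ⊆ ↑F := by
    intro p hp
    rw [Finset.mem_coe, hF, Finset.mem_biUnion]
    refine ⟨p 0, ?_, ?_⟩
    · rw [hT, Multiset.mem_toFinset, mem_roots hN]
      exact hNroot p hp
    · rw [Finset.mem_image]
      refine ⟨p 1, ?_, ?_⟩
      · rw [Multiset.mem_toFinset, mem_roots (hq0 _)]
        exact hqroot p hp
      · funext i
        fin_cases i <;> rfl
  refine ⟨(Finset.finite_toSet F).subset hsub, ?_⟩
  -- the count: `#osc ≤ #F ≤ Σ_(t ∈ T) 2 = 2·#T ≤ 2·deg N ≤ 24 n`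
  have hfib : ∀ t ∈ T, (((X ^ 2 + C (τ.eval t) * X + C (δ.eval t) : ℝ[X]).roots.toFinset).image
      (fun b => (![t, b] : Fin 2 → ℝ))).card ≤ 2 := by
    intro t _
    refine Finset.card_image_le.trans ((Multiset.toFinset_card_le _).trans ((card_roots' _).trans ?_))
    compute_degree!
  calc osc.ncard ≤ (↑F : Set (Fin 2 → ℝ)).ncard := Set.ncard_le_ncard hsub (Finset.finite_toSet F)
    _ = F.card := Set.ncard_coe_finset F
    _ ≤ ∑ t ∈ T, (((X ^ 2 + C (τ.eval t) * X + C (δ.eval t) : ℝ[X]).roots.toFinset).image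
          (fun b => (![t, b] : Fin 2 → ℝ))).card := Finset.card_biUnion_le
    _ ≤ ∑ _t ∈ T, 2 := Finset.sum_le_sum hfib
    _ = 2 * T.card := by rw [Finset.sum_const, smul_eq_mul, mul_comm]
    _ ≤ 2 * N.natDegree := by
        refine Nat.mul_le_mul_left 2 ((Multiset.toFinset_card_le _).trans (card_roots' N))
    _ ≤ 2 * (12 * n) := Nat.mul_le_mul_left 2 (natDegree_cuspN_le τ δ n hτn hδn)
    _ = 24 * n := by ring

end OsculationCensus

end Summit.ValiantsHypothesis.ValiantsHypothesis.Theorems.LacunarySymmetroidMatrixDescartes
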